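import Literature.NumberTheory.IwasawaTheory.ZpExtensionTotallyRamifiedFromLayerOne
import Literature.NumberTheory.EllipticCurves.CyclotomicZpExtensionLayerOneSqrtTwoProofs
import Literature.NumberTheory.EllipticCurves.ZpExtensionRestrictLayers
import Literature.NumberTheory.EllipticCurves.ZpExtensionRestrictCyclotomic
import Mathlib.NumberTheory.NumberField.Discriminant.Different
import HarnessLib

/-!
# The cyclotomic `ℤ₂`-extension of a number field of ODD degree: `√2 ∈ K₁`, the ramification indices
# of the primes of `K₁` above `2` are EVEN, and Fukuda's index is `0` as soon as every prime of `K`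
# above `2` has ODD ramification index (e.g. `2 ∤ d_K`)

Topic `Literature/NumberTheory/IwasawaTheory`, namespace `Literature.NumberTheory.IwasawaTheory`.  THEOREMS
ONLY (no definition, no named fact, no instance; D-0026).  Sequel of `ZpExtensionTotallyRamifiedFromLayerOne.lean`
(Fukuda's index is `0` iff every `w ∣ p` is ramified in the first layer) at `p = 2`.

## What and why (cell `bsd-2adic`, K4 crux C1″ `FineSelmerConjAAtTwoAdditivePotGood`, stmt-BirchSwinnertonDyer-22615)

The per-curve `μ₂`-doors of the cell (Fukuda 1994 Thm. 1, kernel `…_holds`) carry the structural binder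
`TotallyRamifiedFrom κ 0` for the cyclotomic `ℤ₂`-tower of the cubic `2`-torsion point field `F = ℚ(P)` of an
`S₃`-curve; for NON-Galois `F` the tree had no discharge (the Galois-degree-prime-to-`p` argument of
`PrintX8SmallImageTotallyRamified.lean` fails at `p = 2`, `[F:ℚ] = 3`, and indeed the index can be `1`:
census row `306680s1`).  This file gives the PARITY discharge:

* §1 `exists_sq_eq_two_layer_one_of_not_dvd_finrank` — for `2 ∤ [K:ℚ]` every cyclotomic `ℤ₂`-extension `κ`
  of `K` has `√2 ∈ K₁ = κ.layer 1` (`K₁ = K(√2)`): `κ` is a unit twist of the restriction of `κ_cyc` of `ℚ`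
  (tree `surjective_comp_absGaloisRestrict_of_not_dvd_finrank`, `isCyclotomic_restrict`,
  `IsCyclotomic.exists_eq_unitTwist_holds`), whose first layer contains the image of `ℚ_1 ∋ ζ₈ + ζ₈⁻¹`
  (tree `exists_mem_layer_one_sq_eq_two_zpExtension`, `absClosureEmbedding_mem_layer_restrict`).
* §2 `even_ramificationIdx_int_of_sq_eq_two` — if `θ² = 2` in a number field `L`, every prime `Q` of `𝓞 L`
  above `2` has EVEN `e(Q|2)` (`2𝓞_L = (θ)²`, count of `Q` in the factorisation).
* §3 **`not_isUnramifiedIn_layer_one_of_odd_ramificationIdx`** — for `2 ∤ [K:ℚ]`, `κ` cyclotomic and a place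
  `w ∣ 2` of `K` with ODD `e(w|2)`, the place `w` is RAMIFIED in `K₁` (`e(Q|2) = e(w|2)·e(Q|w)`, Mathlib
  `Ideal.ramificationIdx_tower`); hence **`totallyRamifiedFrom_zero_of_forall_odd_ramificationIdx`**: if EVERY
  `w ∣ 2` has odd `e(w|2)` then `TotallyRamifiedFrom κ 0`; in particular
  **`totallyRamifiedFrom_zero_of_not_dvd_discr`**: `2 ∤ d_K` (all `e(w|2) = 1`, Mathlib
  `NumberField.not_dvd_discr_iff_isUnramifiedIn`) ⟹ Fukuda's index is `0` for every cyclotomic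
  `ℤ₂`-extension of `K` — UNCONDITIONAL, any number field of odd degree.

So for a cubic field `F` the binder `hram` of the Fukuda doors is KERNEL whenever `2` is unramified in `F`
(splitting types `𝔭₁𝔭₂`, `𝔭₁𝔭₂𝔭₃`, inert) or totally ramified (`e = 3`); the remaining type `𝔭²𝔮` needs a
certificate at the prime with `e = 2` (sequel file).  No elliptic curve occurs here; BSD is not advanced.

References: [Washington1997] §13.1 (`ℚ_1 = ℚ(√2)`, `L_n = L·K_n` for `L ∩ K_∞ = K`), Prop. 13.2, Lemma 13.3;
[Fukuda1994] p. 264 (the index `n₀`); [NeukirchANT1999] Ch. I §8 (multiplicativity of `e` in towers), Ch. III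
(2.12) (`p ∣ d_K` iff `p` ramifies).
-/

noncomputable section

open scoped NumberField Pointwise
open Multiplicative Polynomial UniqueFactorizationMonoid

namespace Literature.NumberTheory.IwasawaTheory

open Literature.NumberTheory.EllipticCurves Literature.NumberTheory.GaloisRepresentations Field
  IsDedekindDomain NumberField

/-! ## §1 `√2` lies in the first layer of every cyclotomic `ℤ₂`-extension of an odd-degree number field -/

section SqrtTwo

variable {K : Type} [Field K] [NumberField K]

/-- **`√2 ∈ K₁`.**  For a number field `K` with `2 ∤ [K:ℚ]` and a cyclotomic `ℤ₂`-extension `κ` of `K`, the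
first layer `K₁ = κ.layer 1` contains an element of square `2` — `K₁ = K·ℚ_1 = K(√2)` (Washington §13.1:
`ℚ_1 = ℚ(ζ₈)⁺ = ℚ(√2)`, and `K ∩ ℚ_∞ = ℚ` for `[K:ℚ]` odd).  Assembled from the tree: `κ` is a unit twist
(`IsCyclotomic.exists_eq_unitTwist_holds`) of the restriction `κ_cyc ∘ res` (onto by
`surjective_comp_absGaloisRestrict_of_not_dvd_finrank`, cyclotomic by `isCyclotomic_restrict`), whose layers
contain the images of the layers of `ℚ` (`absClosureEmbedding_mem_layer_restrict`), and `√2 ∈ ℚ_1`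
(`CyclotomicZp.exists_mem_layer_one_sq_eq_two_zpExtension`). [cite: Washington1997, §13.1] -/
theorem exists_sq_eq_two_layer_one_of_not_dvd_finrank (hK : ¬ 2 ∣ Module.finrank ℚ K)
    (κ : ZpExtension K 2) (hκ : κ.IsCyclotomic) : ∃ θ : κ.layer 1, θ ^ 2 = 2 := by
  have hsurj := ZpExtension.surjective_comp_absGaloisRestrict_of_not_dvd_finrank
    (CyclotomicZp.zpExtension 2) K hK
  have hcyc : ((CyclotomicZp.zpExtension 2).restrict K hsurj).IsCyclotomic :=
    ZpExtension.isCyclotomic_restrict _ (CyclotomicZp.isCyclotomic_zpExtension 2) K hsurj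
  obtain ⟨u, rfl⟩ := ZpExtension.IsCyclotomic.exists_eq_unitTwist_holds hcyc hκ
  obtain ⟨t, ht, ht2⟩ := CyclotomicZp.exists_mem_layer_one_sq_eq_two_zpExtension
  have hmem : absClosureEmbedding ℚ K t ∈
      (((CyclotomicZp.zpExtension 2).restrict K hsurj).unitTwist u).layer 1 := by
    rw [ZpExtension.layer_unitTwist]
    exact ZpExtension.absClosureEmbedding_mem_layer_restrict _ K hsurj 1 ht
  refine ⟨⟨absClosureEmbedding ℚ K t, hmem⟩, Subtype.ext ?_⟩
  change (absClosureEmbedding ℚ K t) ^ 2 = (2 : AlgebraicClosure K)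
  rw [← map_pow, ht2, map_ofNat]

end SqrtTwo

/-! ## §2 `θ² = 2` forces even ramification indices above `2` -/

section Parity

variable {L : Type*} [Field L] [NumberField L]

omit [NumberField L] in
/-- An element of square `2` of a number field is an algebraic integer. [folklore] -/
private theorem isIntegral_int_of_sq_eq_two {θ : L} (hθ : θ ^ 2 = 2) : IsIntegral ℤ θ := by
  refine ⟨X ^ 2 - C 2, monic_X_pow_sub_C _ two_ne_zero, ?_⟩
  simp [hθ]

/-- **`e(Q|2)` is even when `√2 ∈ L`.**  If `θ² = 2` in the number field `L`, then for every prime `Q` of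
`𝓞 L` above `2` the ramification index `e(Q|2)` is even: `2𝓞_L = (θ)²`, so the exponent of `Q` in the
factorisation of `2𝓞_L` is twice that in `(θ)` (Mathlib `Ideal.IsDedekindDomain.ramificationIdx_eq_normalizedFactors_count`).
[folklore] [cite: NeukirchANT1999, Ch. I §8 (prime factorisation of `p𝓞_L`)] -/
theorem even_ramificationIdx_int_of_sq_eq_two {θ : L} (hθ : θ ^ 2 = 2) (Q : Ideal (𝓞 L))
    [Q.IsPrime] [Q.LiesOver (Ideal.span {(2 : ℤ)})] : Even (Q.ramificationIdx ℤ) := by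
  classical
  set θ' : 𝓞 L := ⟨θ, isIntegral_int_of_sq_eq_two hθ⟩ with hθ'
  have hθ'2 : θ' ^ 2 = 2 := by
    apply Subtype.ext
    change ((θ' ^ 2 : 𝓞 L) : L) = ((2 : 𝓞 L) : L)
    push_cast
    exact hθ
  have hmap : Ideal.map (algebraMap ℤ (𝓞 L)) (Ideal.span {(2 : ℤ)}) = Ideal.span {θ'} ^ 2 := by
    rw [Ideal.map_span, Set.image_singleton, map_ofNat, Ideal.span_singleton_pow, hθ'2]
  have hp0 : Ideal.map (algebraMap ℤ (𝓞 L)) (Ideal.span {(2 : ℤ)}) ≠ ⊥ :=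
    Ideal.map_ne_bot_of_ne_bot (by simp)
  rw [Ideal.IsDedekindDomain.ramificationIdx_eq_normalizedFactors_count (Ideal.span {(2 : ℤ)}) Q hp0,
    hmap, normalizedFactors_pow, Multiset.count_nsmul]
  exact even_two_mul _

end Parity

/-! ## §3 Odd `e(w|2)` forces ramification of `w` in `K₁`, hence Fukuda's index `0` -/

section OddIndex

variable {K : Type} [Field K] [NumberField K]

omit [NumberField K] in
/-- A place of `K` containing `2` lies over `(2) ⊂ ℤ`. [folklore] -/
private theorem liesOver_span_two_of_mem (w : HeightOneSpectrum (𝓞 K)) (hw : ((2 : ℕ) : 𝓞 K) ∈ w.asIdeal) :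
    w.asIdeal.LiesOver (Ideal.span {(2 : ℤ)}) := by
  rw [Ideal.liesOver_span_iff w.isPrime.ne_top Int.prime_two, map_ofNat]
  exact_mod_cast hw

/-- **Odd `e(w|2)` ⟹ `w` ramifies in `K₁ = K(√2)`.**  For a number field `K` with `2 ∤ [K:ℚ]`, a cyclotomic
`ℤ₂`-extension `κ` of `K` and a place `w ∣ 2` of `K` whose ramification index `e(w|2)` over `ℤ` is ODD, the
place `w` is ramified in the first layer `K₁ = κ.layer 1`: for a prime `Q ∣ w` of `𝓞 K₁`,
`e(Q|2) = e(w|2)·e(Q|w)` (Mathlib `Ideal.ramificationIdx_tower`) is even (§2, `√2 ∈ K₁` by §1), so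
`e(Q|w) ≠ 1`. [cite: Washington1997, §13.1] [cite: NeukirchANT1999, Ch. I §8] -/
theorem not_isUnramifiedIn_layer_one_of_odd_ramificationIdx (hK : ¬ 2 ∣ Module.finrank ℚ K)
    (κ : ZpExtension K 2) (hκ : κ.IsCyclotomic) {w : HeightOneSpectrum (𝓞 K)}
    (hw : ((2 : ℕ) : 𝓞 K) ∈ w.asIdeal) (hodd : Odd (w.asIdeal.ramificationIdx ℤ)) :
    ¬ Algebra.IsUnramifiedIn (𝓞 (κ.layer 1)) w.asIdeal := by
  haveI : FiniteDimensional K (κ.layer 1) := κ.finiteDimensional_layer_holds 1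
  haveI : NumberField (κ.layer 1) := NumberField.of_module_finite K _
  intro hunr
  obtain ⟨θ, hθ⟩ := exists_sq_eq_two_layer_one_of_not_dvd_finrank hK κ hκ
  haveI : w.asIdeal.IsPrime := w.isPrime
  haveI := liesOver_span_two_of_mem w hw
  obtain ⟨⟨Q, hQprime, hQover⟩⟩ :=
    (inferInstance : Nonempty (Ideal.primesOver w.asIdeal (𝓞 (κ.layer 1))))
  haveI := hQprime
  haveI := hQover
  haveI : Q.LiesOver (Ideal.span {(2 : ℤ)}) := Ideal.LiesOver.trans Q w.asIdeal _
  have h1 : Q.ramificationIdx (𝓞 K) = 1 := hunr.ramificationIdx_eq_one hQover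
  have heven := even_ramificationIdx_int_of_sq_eq_two hθ Q
  rw [Ideal.ramificationIdx_tower w.asIdeal Q, h1, mul_one] at heven
  exact (Nat.not_even_iff_odd.mpr hodd) heven

/-- **Fukuda's index is `0` when every prime above `2` has odd ramification index.**  For a number field
`K` with `2 ∤ [K:ℚ]` and a cyclotomic `ℤ₂`-extension `κ` of `K`: if every place `w ∣ 2` of `K` has ODD
`e(w|2)`, then every prime of `\bar ℤ_K` is unramified or TOTALLY ramified in `K_∞/K` — `TotallyRamifiedFrom κ 0`
(every `w ∣ 2` is ramified in `K₁`, then `ZpExtensionTotallyRamifiedFromLayerOne`).  Covers the cubic fields in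
which `2` is unramified (`e = 1`) or totally ramified (`e = 3`). [cite: Washington1997, §13.1 Lemma 13.3 (proof)]
[cite: Fukuda1994, p. 264] -/
theorem totallyRamifiedFrom_zero_of_forall_odd_ramificationIdx (hK : ¬ 2 ∣ Module.finrank ℚ K)
    (κ : ZpExtension K 2) (hκ : κ.IsCyclotomic)
    (hodd : ∀ w : HeightOneSpectrum (𝓞 K), ((2 : ℕ) : 𝓞 K) ∈ w.asIdeal →
      Odd (w.asIdeal.ramificationIdx ℤ)) :
    TotallyRamifiedFrom κ 0 :=
  totallyRamifiedFrom_zero_of_forall_not_isUnramifiedIn_layer_one κ fun w hw =>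
    not_isUnramifiedIn_layer_one_of_odd_ramificationIdx hK κ hκ hw (hodd w hw)

/-- **`2 ∤ d_K` ⟹ Fukuda's index is `0`.**  For a number field `K` of odd degree whose (absolute) discriminant
is ODD — i.e. `2` is unramified in `K` (Mathlib `NumberField.not_dvd_discr_iff_isUnramifiedIn`), all `e(w|2) = 1` —
every cyclotomic `ℤ₂`-extension of `K` has `TotallyRamifiedFrom κ 0`.  UNCONDITIONAL; e.g. every cubic field of odd
discriminant (splitting types `𝔭₁𝔭₂`, `𝔭₁𝔭₂𝔭₃`, inert). [cite: Washington1997, §13.1 Lemma 13.3 (proof)]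
[cite: NeukirchANT1999, Ch. III (2.12)] [cite: Fukuda1994, p. 264] -/
theorem totallyRamifiedFrom_zero_of_not_dvd_discr (hK : ¬ 2 ∣ Module.finrank ℚ K)
    (hd : ¬ (2 : ℤ) ∣ NumberField.discr K) (κ : ZpExtension K 2) (hκ : κ.IsCyclotomic) :
    TotallyRamifiedFrom κ 0 := by
  have hunr : Algebra.IsUnramifiedIn (𝓞 K) (Ideal.span {(2 : ℤ)}) :=
    (NumberField.not_dvd_discr_iff_isUnramifiedIn K (𝓞 K) Int.prime_two).mp hd
  refine totallyRamifiedFrom_zero_of_forall_odd_ramificationIdx hK κ hκ fun w hw => ?_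
  haveI : w.asIdeal.IsPrime := w.isPrime
  haveI := liesOver_span_two_of_mem w hw
  rw [hunr.ramificationIdx_eq_one (𝔓 := w.asIdeal) inferInstance]
  exact odd_one

/-- Consumer form («`∀ κ` cyclotomic») of `totallyRamifiedFrom_zero_of_not_dvd_discr`: the binder `hram` of the
tree's Fukuda doors (`IwasawaTheory.classicalMuVanishes_of_relIndex_mul_eq`, the BSD cells'
`…_of_fukudaCertificate_…`) for an odd-degree field of odd discriminant. [cite: Fukuda1994, p. 264] -/
theorem forall_totallyRamifiedFrom_zero_of_not_dvd_discr (hK : ¬ 2 ∣ Module.finrank ℚ K)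
    (hd : ¬ (2 : ℤ) ∣ NumberField.discr K) :
    ∀ κ : ZpExtension K 2, κ.IsCyclotomic → TotallyRamifiedFrom κ 0 :=
  fun κ hκ => totallyRamifiedFrom_zero_of_not_dvd_discr hK hd κ hκ

end OddIndex

end Literature.NumberTheory.IwasawaTheory

end
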